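import Summits.RiemannHypothesis.RiemannHypothesis.Theorems.EvenSectorBartaEvenOneSignedWindowsContinuity
import Summits.RiemannHypothesis.RiemannHypothesis.Theorems.PfPersistenceTowerLawStrength
import Summits.RiemannHypothesis.RiemannHypothesis.Theorems.PfPersistenceGalerkinGroundStateLimit
import Summits.RiemannHypothesis.RiemannHypothesis.Theorems.PfPersistenceFloorRateDichotomy
import HarnessLib

/-!
# PfPersistence (pf seat, gen 7) — the pf T1 CHAIN ASSEMBLED over tree declarations,
# and where the Riemann hypothesis sits in it

Cell `pub-rhpf` (RH Perron–Frobenius persistence), unit `pub-rhpf-pf-g7`.  HONEST FRAMING: long-odds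
MECHANISM SEARCH; **no RH claims**.  Helper file in support of the cell's target item
`EvenSectorBarta.EvenOneSignedWindows` (stmt-RiemannHypothesis-19953).  Everything below is kernel-checked
and RH-free; the two pf "laws" enter ONLY as named hypotheses (`TowerLogLaw` / `TowerDominance` of
`PfPersistenceTowerLaw.lean`, and the `ParityMarginChannel` typed here), asserted for nothing.

THE CHAIN (PF.md §16–§18).  pf's mechanism for one-signed even ground states on large windows has two
inputs: (L) the LEVEL side — the parity tower `ε_od(a)/ε_ev(a) → ∞` (DATA for `ζ`: `log r(a) ≈ 4a`, pf PF-C9),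
which, GIVEN the sign `ε_ev(a) > 0`, puts the even bottom below every fixed multiple `σ·ε_od(a)` of the odd
bottom (`TowerDominance.eventualParityMargin`, tree); (C) the CHANNEL side — the anti-maximum principle for the
polar vector with its threshold pinned to the odd level (DATA: `s_c/ε₁⁻ ∈ [0.977, 1.000)` on every served window
`0.05 ≤ a ≤ 2.2`, pf PF-C8, `PfPersistenceAMPSaturation` / `PfPersistenceAMPWidth`): a positive even bottom
below `σ·ε_od(a)` carries a one-signed ground state.  (C) is typed here, at the continuum level, as
`ParityMarginChannel σ := ∀ᶠ a, 0 < ε_ev a → ε_ev a < σ·ε_od a → OneSignedWindow a`.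

WHAT IS PROVED.
* §1 bookkeeping: item 19953 is `∃ᶠ a in atTop, OneSignedWindow a`
  (`evenOneSignedWindows_iff_frequently_oneSignedWindow`); the Galerkin one-signed certificates of the door
  feed `OneSignedWindow a` through the tree's ground-state limit (`oneSignedWindow_of_frequently_oneSignedAt`).
* §2 THE SIGN BINDER IS RH: `RH ↔ ∀ᶠ a, 0 ≤ ε_ev a ↔ ∃ᶠ a, 0 ≤ ε_ev a`, and `(∃ᶠ a, 0 < ε_ev a) → RH`
  (off RH `ε_ev ≤ −η` on all large windows, tree; under RH `0 ≤ ε_ev`, tree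
  `PfPersistenceFloorRateDichotomy.weilEvenGroundEnergy_nonneg_of_riemannHypothesis'`).
* §3 THE CHANNEL IS RH-SAFE: `¬RH → ParityMarginChannel σ` for every `σ` (its guard `0 < ε_ev a` fails
  eventually), i.e. `ParityMarginChannel σ ∨ RH`; refuting the channel would prove RH.  Antitone in `σ`.
* §4 THE CHAIN: `ParityMarginChannel σ → EventualParityMargin σ → (∀ᶠ a, 0 < ε_ev a) → EvenOneSignedWindows`,
  and with the level side supplied by `TowerDominance` (+ the sign binder) or by the sign-blind `TowerLogLaw`
  ALONE: `evenOneSignedWindows_of_towerLogLaw_of_parityMarginChannel (hσ : 0 < σ) (hlog) (hch)`.  On the way: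
  for the Weil sector bottoms the log law forces both bottoms eventually POSITIVE and hence IS tower dominance
  (`eventually_pos_of_towerLogLaw_weil`, `towerDominance_of_towerLogLaw_weil`) — because the log law already
  implies RH (`riemannHypothesis_of_towerLogLaw_weil`, barrier-typer gen 14, the correction of record V27).

WHAT THIS SAYS ABOUT THE MECHANISM (no credit taken).  In the two-hypothesis form the Riemann hypothesis is
carried ENTIRELY by the level law (`TowerLogLaw ⇒ RH`), and the channel carries none (`¬RH ⇒ channel`); in the
three-hypothesis form it is carried entirely by the sign binder `∀ᶠ a, 0 < ε_ev a` (`⇔ RH` up to strictness),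
bare `TowerDominance` being undecided (typer V27).  So the chain is an EXPLANATION of how one-signedness would
follow from the observed level structure, not a route to RH: no hypothesis here is both RH-free-checkable and
RH-strength.  DATA labels: every number quoted above is floating-point Galerkin output (UNCERTIFIED) from
pub-rhpf-pf/pfprobe/gen2–gen6; nothing in this file depends on it.

References (bib keys of `lean/references.bib`): `Bombieri2000Weil` §4; `Yoshida1992HermitianForms` Prop. 1;
`ConnesConsaniMoscovici2025` (arXiv:2511.22755) Cor. 3.8.
-/

noncomputable section

set_option linter.dupNamespace false  -- the mandated namespace repeats `RiemannHypothesis`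

open Set Filter Asymptotics
open scoped Real Topology

namespace Summit.RiemannHypothesis.RiemannHypothesis.Theorems.PfPersistence

open Literature.NumberTheory.LFunctions PolarPerronFrobenius

/-! ## §1 Window bookkeeping: item 19953 is `∃ᶠ a, OneSignedWindow a` -/

/-- PROVED (bookkeeping): the route item `EvenOneSignedWindows` is exactly "one-signed even ground states on a
cofinal set of windows", i.e. `∃ᶠ a in atTop, OneSignedWindow a`. [folklore] -/
theorem evenOneSignedWindows_iff_frequently_oneSignedWindow :
    Summit.RiemannHypothesis.RiemannHypothesis.Theses.EvenSectorBarta.EvenOneSignedWindows ↔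
      ∃ᶠ a in atTop, OneSignedWindow a := by
  rw [evenOneSignedWindows_iff_cofinal, frequently_atTop]
  exact Iff.rfl

/-- PROVED (bookkeeping). [folklore] -/
theorem evenOneSignedWindows_of_frequently_oneSignedWindow (h : ∃ᶠ a in atTop, OneSignedWindow a) :
    Summit.RiemannHypothesis.RiemannHypothesis.Theses.EvenSectorBarta.EvenOneSignedWindows :=
  evenOneSignedWindows_iff_frequently_oneSignedWindow.2 h

/-- PROVED (bookkeeping): eventual one-signedness suffices. [folklore] -/
theorem evenOneSignedWindows_of_eventually_oneSignedWindow (h : ∀ᶠ a in atTop, OneSignedWindow a) :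
    Summit.RiemannHypothesis.RiemannHypothesis.Theses.EvenSectorBarta.EvenOneSignedWindows :=
  evenOneSignedWindows_of_frequently_oneSignedWindow h.frequently

/-- PROVED (the door-to-continuum bridge, restated on the window predicate): if the `ζ` even blocks at half-length
`a` are one-signed (`zetaDatum ∈ oneSignedAt ⟨a, N, _⟩`, the cell's finite certificate) for arbitrarily large
truncation orders `N`, the window `a` carries a one-signed even ground state (tree:
`exists_oneSigned_evenGroundState_of_frequently_oneSignedAt`, Galerkin ground-state limit). [folklore] -/
theorem oneSignedWindow_of_frequently_oneSignedAt {a : ℝ} (ha : 0 < a)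
    (h : ∃ᶠ N in atTop, zetaDatum ∈ oneSignedAt ⟨a, N, ha⟩) : OneSignedWindow a :=
  exists_oneSigned_evenGroundState_of_frequently_oneSignedAt ha h

/-! ## §2 The sign binder is the Riemann hypothesis -/

/-- PROVED (RH-STRENGTH of the sign, RH-free): if `ε_ev(a) ≥ 0` on arbitrarily large windows then RH — off RH,
`ε_ev(a) ≤ −η < 0` on all large windows (`eventually_weilEvenGroundEnergy_le_neg_of_not_riemannHypothesis`).
[folklore] -/
theorem riemannHypothesis_of_frequently_weilEvenGroundEnergy_nonneg
    (h : ∃ᶠ a in atTop, 0 ≤ weilEvenGroundEnergy a) : RiemannHypothesis := by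
  by_contra hRH
  obtain ⟨η, hη, hev⟩ := eventually_weilEvenGroundEnergy_le_neg_of_not_riemannHypothesis hRH
  obtain ⟨a, ha, ha'⟩ := (h.and_eventually hev).exists
  linarith

/-- PROVED: `(∃ᶠ a, 0 < ε_ev a) → RH`. [folklore] -/
theorem riemannHypothesis_of_frequently_weilEvenGroundEnergy_pos
    (h : ∃ᶠ a in atTop, 0 < weilEvenGroundEnergy a) : RiemannHypothesis :=
  riemannHypothesis_of_frequently_weilEvenGroundEnergy_nonneg (h.mono fun _ ha => ha.le)

/-- PROVED: THE SIGN BINDER of pf's chain, `∀ᶠ a, 0 < ε_ev a`, implies RH on its own. [folklore] -/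
theorem riemannHypothesis_of_eventually_weilEvenGroundEnergy_pos
    (h : ∀ᶠ a in atTop, 0 < weilEvenGroundEnergy a) : RiemannHypothesis :=
  riemannHypothesis_of_frequently_weilEvenGroundEnergy_pos h.frequently

/-- PROVED (RH-EQUIVALENCE; credits nothing): `RH ↔ ε_ev ≥ 0 on all large windows`. [folklore] -/
theorem riemannHypothesis_iff_eventually_weilEvenGroundEnergy_nonneg :
    RiemannHypothesis ↔ ∀ᶠ a in atTop, 0 ≤ weilEvenGroundEnergy a :=
  ⟨fun hRH => Eventually.of_forall (PfPersistenceFloorRateDichotomy.weilEvenGroundEnergy_nonneg_of_riemannHypothesis' hRH),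
    fun h => riemannHypothesis_of_frequently_weilEvenGroundEnergy_nonneg h.frequently⟩

/-- PROVED (RH-EQUIVALENCE; credits nothing): `RH ↔ ε_ev ≥ 0 on arbitrarily large windows` — the
"eventually" and "frequently" sign statements coincide. [folklore] -/
theorem riemannHypothesis_iff_frequently_weilEvenGroundEnergy_nonneg :
    RiemannHypothesis ↔ ∃ᶠ a in atTop, 0 ≤ weilEvenGroundEnergy a :=
  ⟨fun hRH => (riemannHypothesis_iff_eventually_weilEvenGroundEnergy_nonneg.1 hRH).frequently,
    riemannHypothesis_of_frequently_weilEvenGroundEnergy_nonneg⟩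

/-! ## §3 The channel hypothesis (pf PF-C8 + AMP edge channel, continuum form) and its RH-safety -/

/-- TYPED (a HYPOTHESIS, asserted for nothing; pf PF-C8 "σ-pinning" + the AMP edge channel of
`PfPersistenceAMPWidth` / `PfPersistenceAMPSaturation`, continuum form): the PARITY-MARGIN CHANNEL with slack
`σ` — on every large window, a POSITIVE even bottom lying below `σ·ε_od(a)` carries a one-signed even ground
state.  DATA (uncertified Galerkin, pfprobe gen 4–6): the AMP threshold `s_c` of the polar vector satisfies
`s_c/ε₁⁻ ∈ [0.977, 1.000)` on every served window, so the intended slack is any `σ ≤ 0.977`. [folklore] -/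
def ParityMarginChannel (σ : ℝ) : Prop :=
  ∀ᶠ a in atTop, 0 < weilEvenGroundEnergy a →
    weilEvenGroundEnergy a < σ * weilOddGroundEnergy a → OneSignedWindow a

/-- PROVED (unfolding). [folklore] -/
theorem parityMarginChannel_iff {σ : ℝ} :
    ParityMarginChannel σ ↔ ∀ᶠ a in atTop, 0 < weilEvenGroundEnergy a →
      weilEvenGroundEnergy a < σ * weilOddGroundEnergy a → OneSignedWindow a := Iff.rfl

/-- PROVED: the channel is ANTITONE in the slack on `σ > 0` (a smaller slack asks less). [folklore] -/
theorem ParityMarginChannel.anti {σ σ' : ℝ} (h : ParityMarginChannel σ') (hσ : 0 < σ) (hle : σ ≤ σ') :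
    ParityMarginChannel σ := by
  filter_upwards [h] with a ha hpos hlt
  refine ha hpos (hlt.trans_le ?_)
  have hod : 0 < weilOddGroundEnergy a := by
    by_contra hle'
    have : σ * weilOddGroundEnergy a ≤ 0 := mul_nonpos_iff.2 (Or.inl ⟨hσ.le, not_lt.1 hle'⟩)
    linarith
  exact mul_le_mul_of_nonneg_right hle hod.le

/-- PROVED (RH-SAFETY of the channel): OFF RH the channel holds for every slack — its guard `0 < ε_ev a` fails
on all large windows. [folklore] -/
theorem parityMarginChannel_of_not_riemannHypothesis (hRH : ¬RiemannHypothesis) (σ : ℝ) :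
    ParityMarginChannel σ := by
  obtain ⟨η, hη, hev⟩ := eventually_weilEvenGroundEnergy_le_neg_of_not_riemannHypothesis hRH
  filter_upwards [hev] with a ha hpos _
  exact absurd hpos (not_lt.2 (by linarith))

/-- PROVED: so REFUTING the channel (at any slack) would prove RH. [folklore] -/
theorem riemannHypothesis_of_not_parityMarginChannel {σ : ℝ} (h : ¬ParityMarginChannel σ) :
    RiemannHypothesis := by
  by_contra hRH
  exact h (parityMarginChannel_of_not_riemannHypothesis hRH σ)

/-- PROVED: `ParityMarginChannel σ ∨ RH` — the channel carries no RH content of its own. [folklore] -/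
theorem parityMarginChannel_or_riemannHypothesis (σ : ℝ) : ParityMarginChannel σ ∨ RiemannHypothesis := by
  by_cases hRH : RiemannHypothesis
  · exact Or.inr hRH
  · exact Or.inl (parityMarginChannel_of_not_riemannHypothesis hRH σ)

/-! ## §4 The chain -/

/-- PROVED (the chain, sharpest bookkeeping form): a channel valid on ARBITRARILY LARGE windows, an eventual
parity margin with the same slack, and the sign binder give one-signed windows cofinally. [folklore] -/
theorem frequently_oneSignedWindow_of_parityMargin {σ : ℝ}
    (hch : ∃ᶠ a in atTop, 0 < weilEvenGroundEnergy a →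
      weilEvenGroundEnergy a < σ * weilOddGroundEnergy a → OneSignedWindow a)
    (hm : EventualParityMargin weilEvenGroundEnergy weilOddGroundEnergy σ)
    (hev : ∀ᶠ a in atTop, 0 < weilEvenGroundEnergy a) : ∃ᶠ a in atTop, OneSignedWindow a :=
  (hch.and_eventually (Filter.Eventually.and (eventualParityMargin_weil_iff.1 hm) hev)).mono
    fun _ h => h.1 h.2.2 h.2.1

/-- PROVED (the chain, eventual form): `ParityMarginChannel σ`, `EventualParityMargin σ` and the sign binder
give a one-signed even ground state on EVERY large window. [folklore] -/
theorem eventually_oneSignedWindow_of_parityMarginChannel {σ : ℝ} (hch : ParityMarginChannel σ)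
    (hm : EventualParityMargin weilEvenGroundEnergy weilOddGroundEnergy σ)
    (hev : ∀ᶠ a in atTop, 0 < weilEvenGroundEnergy a) : ∀ᶠ a in atTop, OneSignedWindow a := by
  filter_upwards [hch, hm, hev] with a h1 h2 h3
  exact h1 h3 h2

/-- PROVED (the chain reaches the route item): channel + parity margin + sign binder ⇒ `EvenOneSignedWindows`.
[folklore] -/
theorem evenOneSignedWindows_of_parityMarginChannel {σ : ℝ} (hch : ParityMarginChannel σ)
    (hm : EventualParityMargin weilEvenGroundEnergy weilOddGroundEnergy σ)
    (hev : ∀ᶠ a in atTop, 0 < weilEvenGroundEnergy a) :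
    Summit.RiemannHypothesis.RiemannHypothesis.Theses.EvenSectorBarta.EvenOneSignedWindows :=
  evenOneSignedWindows_of_eventually_oneSignedWindow
    (eventually_oneSignedWindow_of_parityMarginChannel hch hm hev)

/-- PROVED (the chain with the LEVEL side from tower dominance): `ParityMarginChannel σ` (`σ > 0`),
`TowerDominance ε_ev ε_od` and the sign binder `∀ᶠ a, 0 < ε_ev a` ⇒ `EvenOneSignedWindows`.  RH content: the
sign binder alone implies RH (§2); the channel is implied by `¬RH` (§3); bare dominance is undecided. [folklore] -/
theorem evenOneSignedWindows_of_towerDominance_of_parityMarginChannel {σ : ℝ} (hσ : 0 < σ)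
    (hch : ParityMarginChannel σ) (hTD : TowerDominance weilEvenGroundEnergy weilOddGroundEnergy)
    (hev : ∀ᶠ a in atTop, 0 < weilEvenGroundEnergy a) :
    Summit.RiemannHypothesis.RiemannHypothesis.Theses.EvenSectorBarta.EvenOneSignedWindows :=
  evenOneSignedWindows_of_parityMarginChannel hch (towerDominance_weil_eventualParityMargin hTD hev hσ) hev

/-- PROVED (generic): under the tower log law both level functions are eventually NON-ZERO (`log r(a) → +∞`
and `Real.log 0 = 0`). [folklore] -/
theorem TowerLogLaw.eventually_ne_zero {εev εod : ℝ → ℝ} (h : TowerLogLaw εev εod) :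
    ∀ᶠ a in atTop, εev a ≠ 0 ∧ εod a ≠ 0 := by
  filter_upwards [h.tendsto_log.eventually_gt_atTop 0] with a ha
  have hr : towerRatio εev εod a ≠ 0 := by
    intro h0
    rw [h0, Real.log_zero] at ha
    exact lt_irrefl _ ha
  rw [towerRatio_def] at hr
  exact ⟨fun h0 => hr (by rw [h0, div_zero]), fun h0 => hr (by rw [h0, zero_div])⟩

/-- PROVED (RH-free; corollary of the correction of record `riemannHypothesis_of_towerLogLaw_weil`): for the
Weil sector bottoms the sign-blind log law forces BOTH bottoms eventually strictly POSITIVE (it implies RH, hence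
`ε_ev, ε_od ≥ 0`, and it makes them non-zero). [folklore] -/
theorem eventually_pos_of_towerLogLaw_weil (h : TowerLogLaw weilEvenGroundEnergy weilOddGroundEnergy) :
    ∀ᶠ a in atTop, 0 < weilEvenGroundEnergy a ∧ 0 < weilOddGroundEnergy a := by
  have hRH := riemannHypothesis_of_towerLogLaw_weil h
  filter_upwards [h.eventually_ne_zero] with a ha
  exact ⟨lt_of_le_of_ne (PfPersistenceFloorRateDichotomy.weilEvenGroundEnergy_nonneg_of_riemannHypothesis' hRH a) ha.1.symm,
    lt_of_le_of_ne (weilOddGroundEnergy_nonneg_of_riemannHypothesis hRH a) ha.2.symm⟩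

/-- PROVED (RH-free): for the Weil sector bottoms the log law IS tower dominance (the relative sign it lacks in
general is supplied by RH, which it implies). [folklore] -/
theorem towerDominance_of_towerLogLaw_weil (h : TowerLogLaw weilEvenGroundEnergy weilOddGroundEnergy) :
    TowerDominance weilEvenGroundEnergy weilOddGroundEnergy :=
  h.towerDominance_of_eventually_pos <| by
    filter_upwards [eventually_pos_of_towerLogLaw_weil h] with a ha
    rw [towerRatio_def]
    exact div_pos ha.2 ha.1

/-- **PROVED (pf's T1 chain in TWO hypotheses): the sign-blind tower log law `log (ε_od(a)/ε_ev(a)) ~ 4a`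
(pf PF-C9, DATA) and the parity-margin channel with any slack `σ > 0` (pf PF-C8 + AMP, DATA `σ ≤ 0.977`) imply
`EvenSectorBarta.EvenOneSignedWindows`.**  Honest reading: the log law ALONE already implies RH
(`riemannHypothesis_of_towerLogLaw_weil`) and the channel is implied by `¬RH`; this theorem records HOW
one-signedness follows from the observed level structure, and claims nothing about `ζ`. [folklore] -/
theorem evenOneSignedWindows_of_towerLogLaw_of_parityMarginChannel {σ : ℝ} (hσ : 0 < σ)
    (hlog : TowerLogLaw weilEvenGroundEnergy weilOddGroundEnergy) (hch : ParityMarginChannel σ) :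
    Summit.RiemannHypothesis.RiemannHypothesis.Theses.EvenSectorBarta.EvenOneSignedWindows :=
  evenOneSignedWindows_of_towerDominance_of_parityMarginChannel hσ hch (towerDominance_of_towerLogLaw_weil hlog)
    ((eventually_pos_of_towerLogLaw_weil hlog).mono fun _ h => h.1)

/-- PROVED (consistency check, no content): the conclusion of the chain implies RH (tree,
`PolarPerronFrobenius.riemannHypothesis_of_evenOneSignedWindows`), as its level hypothesis already did.
[folklore] -/
theorem riemannHypothesis_of_towerLogLaw_of_parityMarginChannel {σ : ℝ} (hσ : 0 < σ)
    (hlog : TowerLogLaw weilEvenGroundEnergy weilOddGroundEnergy) (hch : ParityMarginChannel σ) :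
    RiemannHypothesis :=
  riemannHypothesis_of_evenOneSignedWindows
    (evenOneSignedWindows_of_towerLogLaw_of_parityMarginChannel hσ hlog hch)

end Summit.RiemannHypothesis.RiemannHypothesis.Theorems.PfPersistence

end
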